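import Summits.HubbardSuperconductivity.HubbardSuperconductivity.Theses.LiebTwin
import Summits.HubbardSuperconductivity.HubbardSuperconductivity.Theorems.LiebTwinNoOnsiteODLROLittleOSusceptibility

/-!
# Crux `NoOnsiteODLRO` (stmt-HubbardSuperconductivity-0933; shared by routes `LiebTwin`, `EnslavedA1g`) —
# SKELETON `Lines/birth.lean`, reshaped by lead c2 (rev 2, 2026-08-17): the Kubo–Kishi transplant at `T = 0`,
# off half filling, as WINDOW ∧ (WINDOW ⇒ little-`o` shifted susceptibility)

The crux: for ALL `U > 0`, `δ ∈ (0,1/2)` and every admissible `(N_L, S^z = 0)`-sector ground-state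
sequence `ψ_L` of `hubbardTorus 2 L 1 U`, `S_L := Re⟨ψ_L, P_sᴴ P_s ψ_L⟩ = o(L⁴)` along even `L`
(`P_s = pairField sWave L = √2 Σ_x c_{x↑}c_{x↓} = -√2·etaLower 1`).

LINE (unchanged idea): infrared domination à la Kubo–Kishi 1990 (Thm 2 / Remark 3), moved to sector ground states
at `T = 0` and hole doping; the pair susceptibility is replaced by its `U`-SHIFTED variational form — the
resolvent of `K₋ := H - E_N + U ≥ 0` on the pair-removed sector `(N_L - 2, 0)` (Yang) — and closed by the
zero-temperature Falk–Bruch step through the enslaving identity `K₋ P_s ψ = 2 P_{s'} ψ` (engine landed, p146717 /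
p148448).

WHY REV 2 (lead c2, acting on the disprover's section (d), Cruxes/NoOnsiteODLRO/Disproof.lean, p153023): any
`K₋`-form infrared bound quantified over ALL `v` of the pair-removed sector — with prefactor `C·L²` (birth) or
`ε·L⁴` (c2 rev 1) alike — silently asserts `P_s ψ_L ⊥ ker K₋` eventually, and more generally `S_L = o(w_L·L⁴)` when
the window `w_L := U - (E(N_L,0) - E(N_L-2,0))` closes along the sequence: it is STRICTLY MORE EXPOSED than the
crux exactly off the strict-window branch (`shiftedInfraredBound_forces_kernel_orthogonality`,
`closedWindow_iff_exists_zeroMode`). The disprover's repair "carry `StrictPairWindow` as an explicit hypothesis"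
is adopted: the skeleton is now the conjunction of

* `stub_strictPairWindow` (OPEN in the middle of the `U`-axis; census B4 — the separable, tractable piece every
  line on this crux needs): along every admissible sequence the pair window is eventually bounded below,
  `∃ κ > 0, ∃ L₁, ∀ even L ≥ L₁, κ ≤ U - (E(N_L,0) - E(N_L-2,0))`. LANDED ENDS: weak coupling `0 ≤ U ≤ U₁(δ)`,
  `δ ∈ [1/10,2/5]` (`WeakCoupling.stub_weakCouplingPairWindow`, p154876) and strong coupling `U > 144/√δ`
  (`LargeU.stub_kineticPairWindow` / `pairWindow_ge_largeU`, p149214 / p149426); the middle range is open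
  (correlated trial states; in substance a piece of the convexity of `E(N)` in `N`).
* `stub_littleOShiftedSusceptibilityOfWindow` (OPEN core — crux-EQUIVALENT, no longer stronger): GIVEN a strict
  window along the sequence, the little-`o` `U`-shifted susceptibility bound
  `∀ ε > 0, eventually, ∀ v ∈ szSector (N_L-2) 0: |⟨v, P_s ψ_L⟩|² ≤ ε·L⁴·Re⟨v, K₋ v⟩`. It follows from the crux
  along the same sequence by Cauchy–Schwarz and `Re⟨v,K₋v⟩ ≥ κ‖v‖²` (the argument of the landed
  `littleO_susceptibility_of_noOnsiteODLRO`, p148448), and with the window it implies the crux (composition below).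
* Composition `NoOnsiteODLRO_of : Theses.LiebTwin.NoOnsiteODLRO` — the crux BY NAME: window ⇒ little-`o` bound ⇒
  per-side Falk–Bruch engine `falkBruch_fixedSide` (landed) ⇒ `S_L³ ≤ 4c₀² ε'² L¹² ≤ (εL⁴)³`. The same composition is
  LANDED as the tree theorem `Birth.stub_windowLittleOGlue` / `noOnsiteODLRO_of_window_of_littleO` (p156609,
  Theorems/LiebTwinNoOnsiteODLROWindowLittleOGlue.lean).

Landed HELPER theorems of this line (all `--supports stmt-HubbardSuperconductivity-0933`; not composition pieces):
c1 — p146717 (engine), p148448 (little-`o` glue both ways), p148497/p149214/p149426 (large-`U` window and the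
shadow `S_L ≤ 128L⁴/(U-144/√δ)²`); c2 wave 1 — p153497 `stub_etaVacuumOfStrictWindow` (strict window ⇒ `ηψ_L = 0`),
p154303 `stub_pseudospinAlgebra` (`[η_Q,ρ_Q] = 2η₀`, `[ρ_Q,[ρ_Q,T]] = 4T`), p154611 `stub_pseudospinOnsiteCeiling`
(`w_L·S_L ≤ -(L²-N_L+2)·Re⟨ψ_L,Tψ_L⟩`, every real `U` — census B3; the operator-level proof is seat LiebTwin-0's
p152768, with the density corollary `S_L/L⁴ ≤ 4δ(1-δ)/κ + ε`, p153034), p154723 `stub_pairFieldCommutators`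
(`[P_s,P_{s'}ᴴ] = 2T`), p155562 `stub_compressibilitySandwich` (`(E_{N+2}-2E_N+E_{N-2})·S_L ≤ 2κ₊(L²-N) - 4Re⟨ψ,Tψ⟩`
— census T5), p154876 `stub_weakCouplingPairWindow`; c2 wave 2 — p156492 `stub_weakCouplingPairWindowAllDoping`
(strict window for EVERY `δ ∈ (0,1/2)`: `κ = δ²/4` for `0 ≤ U ≤ δ³/32`, `L ≥ ⌈5/δ⌉+3`).

Disproof used: `noOnsiteODLRO_false_without_groundState` (p149867: eigen-equation load-bearing — every stub here is
spectral), `shiftedInfraredBound_forces_kernel_orthogonality` + `closedWindow_iff_exists_zeroMode` (p153023: the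
reason for rev 2), `exists_admissible_free_seq_onsitePairNumber_eq` / `not_noOnsiteODLRORateTwoNonneg` (p154305:
no rate below `L²` — the little-`o` core asks none). `-- Targets`: the old stub only; nothing here is hit.
-/

noncomputable section

set_option linter.dupNamespace false

namespace Summit.HubbardSuperconductivity.HubbardSuperconductivity.Cruxes.NoOnsiteODLRO.Birth

open Matrix Finset Filter
open scoped ComplexOrder
open Literature.Probability.LatticeModels Literature.MathematicalPhysics.QuantumLattice

/-! ## Stubs -/

/-- STUB 1 (OPEN in the middle `U`-range — the STRICT PAIR WINDOW, census B4). For all `U > 0`, `δ ∈ (0,1/2)` and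
every admissible sector ground-state sequence `(N, ψ)` there are `κ > 0` and `L₁` such that for every even `L ≥ L₁`
`κ ≤ U - (E(N_L, 0) - E(N_L - 2, 0))`, `E(n,0) = minEnergyOn (hubbardTorus 2 L 1 U) (szSector n 0)`: removing a pair
from the doped repulsive ground state gains strictly less than `U` ("`2μ < U` at `δ > 0`"). `0 ≤` is Yang's bound
(landed); strictness is landed for `0 ≤ U ≤ U₁(δ)`, `δ ∈ [1/10,2/5]` (p154876) and for `U > 144/√δ` (p149214);
open in between. [Yang1989, eq. (6); LiebPRL1989; KuboKishi1990, Remark 3] -/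
theorem stub_strictPairWindow :
    ∀ (U δ : ℝ), 0 < U → δ ∈ Set.Ioo (0 : ℝ) (1 / 2) →
      ∀ (N : ℕ → ℕ) (ψ : ∀ L, Fock (Orb (FermionTorus 2 L))),
        (∀ L, Even L → N L = 2 * ⌊(1 - δ) * (L : ℝ) ^ 2 / 2⌋₊ ∧ star (ψ L) ⬝ᵥ ψ L = 1 ∧
            IsGroundStateInSector (hubbardTorus 2 L 1 U) (N L) 0 (ψ L)) →
          ∃ κ : ℝ, 0 < κ ∧ ∃ L₁ : ℕ, ∀ (L : ℕ) [NeZero L], Even L → L₁ ≤ L →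
            κ ≤ U - ((hubbardTorus 2 L 1 U).minEnergyOn (szSector (Λ := FermionTorus 2 L) (N L) 0) -
              (hubbardTorus 2 L 1 U).minEnergyOn (szSector (Λ := FermionTorus 2 L) (N L - 2) 0)) := by
  sorry

/-- STUB 2 (OPEN core — the doped, zero-temperature Kubo–Kishi bound in little-`o`, `U`-shifted variational form,
CONDITIONAL on a strict window along the sequence; crux-equivalent). For all `U > 0`, `δ ∈ (0,1/2)`, every admissible
`(N, ψ)`, every `κ > 0` and `L₁` such that the pair window is `≥ κ` at every even `L ≥ L₁`, and every `ε > 0`, there is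
`L₀` such that for every even `L ≥ L₀` and EVERY `v` of the pair-removed sector `(N_L - 2, S^z = 0)`:
`|⟨v, P_s ψ_L⟩|² ≤ ε · L⁴ · ( Re⟨v, H v⟩ + (U - E_{N_L}) ‖v‖² )` (`K₋`-form; `K₋ ≥ κ > 0` on that sector, so no hidden
kernel assertion remains). [KuboKishi1990, Thm 2 and Remark 3; DysonLiebSimon1978; Yang1989] -/
theorem stub_littleOShiftedSusceptibilityOfWindow :
    ∀ (U δ : ℝ), 0 < U → δ ∈ Set.Ioo (0 : ℝ) (1 / 2) →
      ∀ (N : ℕ → ℕ) (ψ : ∀ L, Fock (Orb (FermionTorus 2 L))),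
        (∀ L, Even L → N L = 2 * ⌊(1 - δ) * (L : ℝ) ^ 2 / 2⌋₊ ∧ star (ψ L) ⬝ᵥ ψ L = 1 ∧
            IsGroundStateInSector (hubbardTorus 2 L 1 U) (N L) 0 (ψ L)) →
          ∀ κ : ℝ, 0 < κ → ∀ L₁ : ℕ,
            (∀ (L : ℕ) [NeZero L], Even L → L₁ ≤ L →
              κ ≤ U - ((hubbardTorus 2 L 1 U).minEnergyOn (szSector (Λ := FermionTorus 2 L) (N L) 0) -
                (hubbardTorus 2 L 1 U).minEnergyOn (szSector (Λ := FermionTorus 2 L) (N L - 2) 0))) →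
            ∀ ε : ℝ, 0 < ε → ∃ L₀ : ℕ, ∀ (L : ℕ) [NeZero L], Even L → L₀ ≤ L →
              ∀ v : Fock (Orb (FermionTorus 2 L)), v ∈ szSector (Λ := FermionTorus 2 L) (N L - 2) 0 →
                ‖star v ⬝ᵥ ((pairField sWave L) *ᵥ (ψ L))‖ ^ 2 ≤
                  ε * (L : ℝ) ^ 4 *
                    ((expect (hubbardTorus 2 L 1 U) v).re +
                      (U - (hubbardTorus 2 L 1 U).minEnergyOn (szSector (Λ := FermionTorus 2 L) (N L) 0)) *
                        (star v ⬝ᵥ v).re) := by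
  sorry

/-! ## Composition -/

/-- COMPOSITION, hypothesis form (sorry-free, axioms `propext/Classical.choice/Quot.sound` only):
Stub 1 → Stub 2 → the body of the crux `NoOnsiteODLRO` VERBATIM. Per sequence: the window constants `(κ, L₁)` of
Stub 1 feed Stub 2; its little-`o` bound at tolerance `ε' = min(1,ε)³/(K₀+1)` (`K₀ = 4c₀²`) feeds the landed per-side
engine `falkBruch_fixedSide` (`S_L³ ≤ K₀ ε'² L¹² ≤ (εL⁴)³`). Pure real analysis around two tree theorems. -/
theorem NoOnsiteODLRO_of_stubs
    (hW : ∀ (U δ : ℝ), 0 < U → δ ∈ Set.Ioo (0 : ℝ) (1 / 2) →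
      ∀ (N : ℕ → ℕ) (ψ : ∀ L, Fock (Orb (FermionTorus 2 L))),
        (∀ L, Even L → N L = 2 * ⌊(1 - δ) * (L : ℝ) ^ 2 / 2⌋₊ ∧ star (ψ L) ⬝ᵥ ψ L = 1 ∧
            IsGroundStateInSector (hubbardTorus 2 L 1 U) (N L) 0 (ψ L)) →
          ∃ κ : ℝ, 0 < κ ∧ ∃ L₁ : ℕ, ∀ (L : ℕ) [NeZero L], Even L → L₁ ≤ L →
            κ ≤ U - ((hubbardTorus 2 L 1 U).minEnergyOn (szSector (Λ := FermionTorus 2 L) (N L) 0) -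
              (hubbardTorus 2 L 1 U).minEnergyOn (szSector (Λ := FermionTorus 2 L) (N L - 2) 0)))
    (hχ : ∀ (U δ : ℝ), 0 < U → δ ∈ Set.Ioo (0 : ℝ) (1 / 2) →
      ∀ (N : ℕ → ℕ) (ψ : ∀ L, Fock (Orb (FermionTorus 2 L))),
        (∀ L, Even L → N L = 2 * ⌊(1 - δ) * (L : ℝ) ^ 2 / 2⌋₊ ∧ star (ψ L) ⬝ᵥ ψ L = 1 ∧
            IsGroundStateInSector (hubbardTorus 2 L 1 U) (N L) 0 (ψ L)) →
          ∀ κ : ℝ, 0 < κ → ∀ L₁ : ℕ,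
            (∀ (L : ℕ) [NeZero L], Even L → L₁ ≤ L →
              κ ≤ U - ((hubbardTorus 2 L 1 U).minEnergyOn (szSector (Λ := FermionTorus 2 L) (N L) 0) -
                (hubbardTorus 2 L 1 U).minEnergyOn (szSector (Λ := FermionTorus 2 L) (N L - 2) 0))) →
            ∀ ε : ℝ, 0 < ε → ∃ L₀ : ℕ, ∀ (L : ℕ) [NeZero L], Even L → L₀ ≤ L →
              ∀ v : Fock (Orb (FermionTorus 2 L)), v ∈ szSector (Λ := FermionTorus 2 L) (N L - 2) 0 →
                ‖star v ⬝ᵥ ((pairField sWave L) *ᵥ (ψ L))‖ ^ 2 ≤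
                  ε * (L : ℝ) ^ 4 *
                    ((expect (hubbardTorus 2 L 1 U) v).re +
                      (U - (hubbardTorus 2 L 1 U).minEnergyOn (szSector (Λ := FermionTorus 2 L) (N L) 0)) *
                        (star v ⬝ᵥ v).re)) :
    -- the body of `Theses.LiebTwin.NoOnsiteODLRO` (= `Theses.EnslavedA1g.NoOnsiteODLRO`), verbatim:
    ∀ (U δ : ℝ), 0 < U → δ ∈ Set.Ioo (0 : ℝ) (1 / 2) →
      ∀ (N : ℕ → ℕ) (ψ : ∀ L, Fock (Orb (FermionTorus 2 L))),
        (∀ L, Even L → N L = 2 * ⌊(1 - δ) * (L : ℝ) ^ 2 / 2⌋₊ ∧ star (ψ L) ⬝ᵥ ψ L = 1 ∧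
            IsGroundStateInSector (hubbardTorus 2 L 1 U) (N L) 0 (ψ L)) →
          ∀ ε : ℝ, 0 < ε → ∃ L₀ : ℕ, ∀ (L : ℕ) [NeZero L], Even L → L₀ ≤ L →
            (expect (Matrix.conjTranspose (pairField sWave L) * pairField sWave L) (ψ L)).re / (L : ℝ) ^ 4 ≤ ε := by
  intro U δ hU hδ N ψ hyp ε hε
  -- Stub 1 along this sequence, fed into Stub 2
  obtain ⟨κ, hκ, L₁, hW'⟩ := hW U δ hU hδ N ψ hyp
  have hχ' := hχ U δ hU hδ N ψ hyp κ hκ L₁ (fun L _ hE hL => hW' L hE hL)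
  -- the engine constant `K₀ = 4 c₀²`
  set K₀ : ℝ := 4 * (∑ e ∈ insert (0 : Site 2) unitSteps, ‖((extendedSWave e / Real.sqrt 2 : ℝ) : ℂ)‖ * 2) ^ 2
    with hK₀def
  have hK₀ : 0 ≤ K₀ := by positivity
  -- the auxiliary tolerance `ε' = min 1 ε ^ 3 / (K₀ + 1)` : `ε' ≤ 1` and `K₀ ε'² ≤ (min 1 ε)³ ≤ ε³`
  set μ : ℝ := min 1 ε with hμdef
  have hμpos : 0 < μ := lt_min one_pos hε
  have hμ1 : μ ≤ 1 := min_le_left _ _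
  have hμε : μ ≤ ε := min_le_right _ _
  have hK1 : 0 < K₀ + 1 := by linarith
  set ε' : ℝ := μ ^ 3 / (K₀ + 1) with hε'def
  have hε'pos : 0 < ε' := div_pos (pow_pos hμpos 3) hK1
  have hμ3 : μ ^ 3 ≤ 1 := pow_le_one₀ hμpos.le hμ1
  have hε'1 : ε' ≤ 1 := by
    rw [hε'def, div_le_one hK1]
    linarith
  have hKε : K₀ * ε' ^ 2 ≤ μ ^ 3 := by
    have h1 : ε' ^ 2 ≤ ε' := by nlinarith
    calc K₀ * ε' ^ 2 ≤ (K₀ + 1) * ε' := by nlinarith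
      _ = μ ^ 3 := by rw [hε'def]; field_simp
  obtain ⟨L₀, hL₀⟩ := hχ' ε' hε'pos
  refine ⟨L₀ + 3, fun L _ hEv hL => ?_⟩
  obtain ⟨hN, hψ1, hGS⟩ := hyp L hEv
  have hL3 : 3 ≤ L := by omega
  -- `2 ≤ N L`
  have hN2 : 2 ≤ N L := by
    rw [hN]
    have hδ1 : 1 / 2 < 1 - δ := by linarith [hδ.2]
    have hL3' : (3 : ℝ) ≤ L := by exact_mod_cast hL3
    have hL9 : (9 : ℝ) ≤ (L : ℝ) ^ 2 := by nlinarith [hL3']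
    have h1 : ((1 : ℕ) : ℝ) ≤ (1 - δ) * (L : ℝ) ^ 2 / 2 := by
      rw [Nat.cast_one, le_div_iff₀ (by norm_num : (0 : ℝ) < 2)]
      nlinarith
    have h1' : 1 ≤ ⌊(1 - δ) * (L : ℝ) ^ 2 / 2⌋₊ := Nat.le_floor h1
    omega
  -- the engine at prefactor `A = ε' L⁴`
  have hA : 0 ≤ ε' * (L : ℝ) ^ 4 := by positivity
  have hS3 : (expect ((pairField sWave L)ᴴ * pairField sWave L) (ψ L)).re ^ 3 ≤
      K₀ * (ε' * (L : ℝ) ^ 4) ^ 2 * (L : ℝ) ^ 4 :=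
    Summit.HubbardSuperconductivity.NoOnsiteODLRO.Birth.falkBruch_fixedSide hL3 U hN2 hψ1 hGS hA
      (hL₀ L hEv (by omega))
  have hLpos : (0 : ℝ) < (L : ℝ) := by exact_mod_cast (show 0 < L by omega)
  have hL4 : (0 : ℝ) < (L : ℝ) ^ 4 := by positivity
  rw [div_le_iff₀ hL4]
  refine le_of_pow_le_pow_left₀ (n := 3) (by norm_num) (by positivity) ?_
  calc (expect ((pairField sWave L)ᴴ * pairField sWave L) (ψ L)).re ^ 3
      ≤ K₀ * (ε' * (L : ℝ) ^ 4) ^ 2 * (L : ℝ) ^ 4 := hS3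
    _ = (K₀ * ε' ^ 2) * (L : ℝ) ^ 12 := by ring
    _ ≤ μ ^ 3 * (L : ℝ) ^ 12 := mul_le_mul_of_nonneg_right hKε (by positivity)
    _ ≤ ε ^ 3 * (L : ℝ) ^ 12 :=
        mul_le_mul_of_nonneg_right (pow_le_pow_left₀ hμpos.le hμε 3) (by positivity)
    _ = (ε * (L : ℝ) ^ 4) ^ 3 := by ring

/-- THE SKELETON THEOREM — the crux `NoOnsiteODLRO` BY NAME (route `LiebTwin`'s decl; the `EnslavedA1g` copy is
`Iff.rfl`-equal): the two registered stubs fed into `NoOnsiteODLRO_of_stubs`. Its only non-whitelisted axiom is the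
stubs' `sorryAx`; it becomes a proof of the crux the moment both stubs are theorems. -/
theorem NoOnsiteODLRO_of :
    Summit.HubbardSuperconductivity.HubbardSuperconductivity.Theses.LiebTwin.NoOnsiteODLRO :=
  NoOnsiteODLRO_of_stubs stub_strictPairWindow stub_littleOShiftedSusceptibilityOfWindow

end Summit.HubbardSuperconductivity.HubbardSuperconductivity.Cruxes.NoOnsiteODLRO.Birth
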